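import Literature.NumberTheory.GaloisRepresentations.UnramifiedResidueNorm
import Literature.NumberTheory.EllipticCurves.KummerUnramifiedConverse
import Mathlib.RingTheory.Frobenius
import Mathlib.NumberTheory.NumberField.Norm
import Mathlib.NumberTheory.NumberField.Ideal.Basic
import Mathlib.NumberTheory.RamificationInertia.Galois
import HarnessLib

/-!
# Norms modulo a completely split prime, and complete splitting of Kummer extensions

Topic `NumberTheory/GaloisRepresentations` (next to `UnramifiedResidueNorm.lean`: Childress,
*Class Field Theory*, Ch. 4 §5 Lemma 5.3 (a), the norm on units of an UNRAMIFIED extension modulo a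
prime); namespace `Literature.NumberTheory.GaloisRepresentations.SplitNorm`. Everything PROVED; no
named facts; no definitions except the finset `primesOverFinset v` of the places above `v`.

For a finite Galois extension of number fields `E/F` with group `G`, a finite place `v` of `F` and a
place `w₀ ∣ v` of `E` at which `G` acts FREELY (`σ w₀ = w₀ ⇒ σ = 1`, i.e. the decomposition group of
`w₀` is trivial: `v` is completely split in `E`), the places above `v` are the `σ w₀`, `σ ∈ G`, without
repetition, all of residue degree one; and for `δ ∈ 𝓞 E` with residues represented by `r(w) ∈ 𝓞 F`
(`δ ≡ r(w) (mod w)` for every `w ∣ v`):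

  `N_{E/F}(δ) ≡ ∏_{w ∣ v} r(w)  (mod v)`     (`norm_sub_prod_mem_of_free`)

(the factors `σ δ ≡ r(σ⁻¹ w₀)` of `N(δ) = ∏_σ σ δ` modulo `w₀`: Marcus, *Number Fields*, Ch. 4,
proof of Thm. 33 / Childress loc. cit.). We also give the two criteria producing free actions for
extensions generated by roots `α` of `a ∈ 𝓞 F` (`α^d = a`), at places `v ∤ d·a`:

* `inertia_eq_bot_of_forall_smul_eq` — if every element of the inertia group of `w₀` fixes a set of
  generators of `E/F` then the inertia group is trivial (for `d`-th roots of `v`-units this is the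
  tree's `smul_eq_self_of_mem_inertia_of_pow_eq`, `KummerUnramifiedConverse.lean`: Lang,
  *Fundamentals of Diophantine Geometry*, Ch. 6 Prop. 1.3);
* `smul_eq_self_of_isArithFrobAt` — a Frobenius `σ` at `w₀` (Mathlib `IsArithFrobAt`: `σ x ≡ x^{Nv}`)
  fixes every `d`-th root `α ∈ 𝓞 E` of `a ∈ 𝓞 F` which is a `d`-th power residue modulo `v`
  (`a^{(Nv-1)/d} ≡ 1`): `σ α ≡ α^{Nv} = α · a^{(Nv-1)/d} ≡ α`, and distinct `d`-th roots of the `v`-unit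
  `a` stay distinct modulo `w₀` (`eq_of_pow_eq_pow_of_sub_mem`);
* `free_of_inertia_eq_bot_of_isArithFrobAt_one` — if the inertia group of `w₀` is trivial and the identity
  is a Frobenius at `w₀` (`x ≡ x^{Nv} (mod w₀)` for all `x`, i.e. the residue field of `w₀` is that of
  `v`), then `G` acts freely at `w₀`: every element of the residue field of `w₀` is a root of
  `X^{Nv} - X`, so `𝓞 F → 𝓞 E/w₀` is onto, and an automorphism fixing `w₀` then lies in the (trivial)
  inertia group.

## References

* D. A. Marcus, *Number Fields*, Universitext, Springer (2nd ed. 2018; 1st ed. 1977), Ch. 4, Thm. 33 and its proof (Frobenius, splitting of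
  primes, `N(α) ≡ ∏` over the decomposition). [Marcus2018]
* N. Childress, *Class Field Theory*, Universitext, Springer 2009, Ch. 4 §5 Lemma 5.3. [Childress2009]
* S. Lang, *Fundamentals of Diophantine Geometry*, Springer 1983, Ch. 6 Prop. 1.3. [Lang1983]
-/

noncomputable section

open NumberField IsDedekindDomain
open scoped Pointwise

namespace Literature.NumberTheory.GaloisRepresentations

namespace SplitNorm

open Literature.NumberTheory.Automorphic

variable {F : Type*} [Field F] [NumberField F] {E : Type*} [Field E] [NumberField E] [Algebra F E]

/-! ### The places above `v` -/

/-- The finite set of places of `E` above the place `v` of `F`. [folklore] -/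
def primesOverFinset (v : HeightOneSpectrum (𝓞 F)) : Finset (HeightOneSpectrum (𝓞 E)) :=
  (IsDedekindDomain.primesOver_finite v.asIdeal (𝓞 E)).toFinset.preimage HeightOneSpectrum.asIdeal
    (fun _ _ _ _ h ↦ HeightOneSpectrum.ext h)

/-- Membership in `primesOverFinset`: `w ∣ v`. [folklore] -/
theorem mem_primesOverFinset {v : HeightOneSpectrum (𝓞 F)} {w : HeightOneSpectrum (𝓞 E)} :
    w ∈ primesOverFinset (E := E) v ↔ w.under (𝓞 F) = v := by
  rw [primesOverFinset, Finset.mem_preimage, Set.Finite.mem_toFinset]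
  constructor
  · rintro ⟨_, hover⟩
    exact HeightOneSpectrum.ext hover.over.symm
  · intro h
    exact ⟨w.isPrime, ⟨by rw [← h]; rfl⟩⟩

/-! ### Free actions: the orbit map is a bijection onto the places above `v` -/

/-- If `G = Gal(E/F)` acts freely at `w₀ ∣ v`, then `σ ↦ σ⁻¹ w₀` is a bijection from `G` onto the
places above `v` (transitivity: `HeightOneSpectrum.exists_algEquiv_smul_eq`). [folklore] -/
theorem bijOn_inv_smul_of_free [IsGalois F E] {v : HeightOneSpectrum (𝓞 F)}
    {w₀ : HeightOneSpectrum (𝓞 E)} (hw₀ : w₀.under (𝓞 F) = v)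
    (hfree : ∀ σ : E ≃ₐ[F] E, σ • w₀ = w₀ → σ = 1) :
    Set.BijOn (fun σ : E ≃ₐ[F] E ↦ σ⁻¹ • w₀) Set.univ (primesOverFinset (E := E) v : Set _) := by
  refine ⟨fun σ _ ↦ ?_, fun σ _ τ _ h ↦ ?_, fun w hw ↦ ?_⟩
  · rw [Finset.mem_coe, mem_primesOverFinset, HeightOneSpectrum.under_algEquiv_smul, hw₀]
  · -- injective: `σ⁻¹ w₀ = τ⁻¹ w₀ ⇒ (τ σ⁻¹) w₀ = w₀`
    have h1 : (τ * σ⁻¹) • w₀ = w₀ := by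
      have := congrArg (fun w ↦ τ • w) h
      simpa only [mul_smul, smul_inv_smul] using this
    have h2 := hfree _ h1
    rw [mul_inv_eq_one] at h2
    exact h2.symm
  · rw [Finset.mem_coe, mem_primesOverFinset] at hw
    obtain ⟨σ, hσ⟩ := HeightOneSpectrum.exists_algEquiv_smul_eq (F := F) (hw₀.trans hw.symm)
    exact ⟨σ⁻¹, Set.mem_univ _, by simp only [inv_inv, hσ]⟩

/-! ### The norm modulo a completely split prime -/

omit [NumberField F] [NumberField E] in
/-- `σ` fixes the elements of `𝓞 F` inside `𝓞 E`. [folklore] -/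
theorem algEquiv_smul_algebraMap (σ : E ≃ₐ[F] E) (x : 𝓞 F) :
    σ • algebraMap (𝓞 F) (𝓞 E) x = algebraMap (𝓞 F) (𝓞 E) x :=
  smul_algebraMap σ x

/-- **The norm modulo a completely split prime.** Let `E/F` be a finite Galois extension of number
fields with group `G`, `v` a finite place of `F` and `w₀ ∣ v` a place of `E` at which `G` acts freely
(the decomposition group of `w₀` is trivial). If `δ ∈ 𝓞 E` satisfies `δ ≡ r(w) (mod w)` with
`r(w) ∈ 𝓞 F` for every place `w ∣ v`, then `N_{E/F}(δ) ≡ ∏_{w ∣ v} r(w) (mod v)`.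
Proof: `N(δ) = ∏_σ σ δ` and `σ δ ≡ r(σ⁻¹ w₀) (mod w₀)`; `σ ↦ σ⁻¹ w₀` is a bijection onto the places
above `v`; finally `w₀ ∩ 𝓞 F = v`. [cite: Marcus2018, Ch. 4, Thm. 33 (proof)] -/
theorem norm_sub_prod_mem_of_free [IsGalois F E] {v : HeightOneSpectrum (𝓞 F)}
    {w₀ : HeightOneSpectrum (𝓞 E)} (hw₀ : w₀.under (𝓞 F) = v)
    (hfree : ∀ σ : E ≃ₐ[F] E, σ • w₀ = w₀ → σ = 1) (δ : 𝓞 E)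
    (r : HeightOneSpectrum (𝓞 E) → 𝓞 F)
    (hr : ∀ w : HeightOneSpectrum (𝓞 E), w.under (𝓞 F) = v → δ - algebraMap (𝓞 F) (𝓞 E) (r w) ∈ w.asIdeal) :
    RingOfIntegers.norm F δ - ∏ w ∈ primesOverFinset (E := E) v, r w ∈ v.asIdeal := by
  classical
  set G := E ≃ₐ[F] E
  -- each factor modulo `w₀`
  have hfac : ∀ σ : G, σ • δ - algebraMap (𝓞 F) (𝓞 E) (r (σ⁻¹ • w₀)) ∈ w₀.asIdeal := by
    intro σ
    have h1 : (σ⁻¹ • w₀).under (𝓞 F) = v := by rw [HeightOneSpectrum.under_algEquiv_smul, hw₀]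
    have h2 := hr _ h1
    rw [HeightOneSpectrum.smul_asIdeal] at h2
    have h3 : σ • (δ - algebraMap (𝓞 F) (𝓞 E) (r (σ⁻¹ • w₀))) ∈ σ • (σ⁻¹ • w₀.asIdeal) :=
      Ideal.smul_mem_pointwise_smul_iff.mpr h2
    rwa [smul_inv_smul, smul_sub, algEquiv_smul_algebraMap] at h3
  -- the product modulo `w₀`, reindexed along the bijection `σ ↦ σ⁻¹ w₀`
  have hprod : (∏ σ : G, σ • δ) - algebraMap (𝓞 F) (𝓞 E) (∏ w ∈ primesOverFinset (E := E) v, r w) ∈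
      w₀.asIdeal := by
    rw [map_prod, ← Ideal.Quotient.eq, map_prod, map_prod]
    have hbij := bijOn_inv_smul_of_free hw₀ hfree
    exact Finset.prod_nbij (fun σ : G ↦ σ⁻¹ • w₀)
      (fun σ _ ↦ hbij.mapsTo (Set.mem_univ σ))
      (fun σ _ τ _ h ↦ hbij.injOn (Set.mem_univ σ) (Set.mem_univ τ) h)
      (fun w hw ↦ by
        obtain ⟨σ, -, hσ⟩ := hbij.surjOn hw
        exact ⟨σ, Finset.mem_coe.mpr (Finset.mem_univ σ), hσ⟩)
      (fun σ _ ↦ (Ideal.Quotient.eq).mpr (hfac σ))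
  -- conclude modulo `w₀ ∩ 𝓞 F = v`
  have hmem : algebraMap (𝓞 F) (𝓞 E) (RingOfIntegers.norm F δ - ∏ w ∈ primesOverFinset (E := E) v, r w) ∈
      w₀.asIdeal := by
    rw [map_sub, ResidueNorm.algebraMap_norm_eq_prod]
    exact hprod
  have : RingOfIntegers.norm F δ - ∏ w ∈ primesOverFinset (E := E) v, r w ∈
      w₀.asIdeal.comap (algebraMap (𝓞 F) (𝓞 E)) := hmem
  rwa [← Ideal.under_def, show w₀.asIdeal.under (𝓞 F) = v.asIdeal from congrArg HeightOneSpectrum.asIdeal hw₀]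
    at this

/-! ### Criteria for free actions -/

omit [NumberField F] [NumberField E] in
/-- **Inertia fixing generators is trivial.** If every element of the inertia group `I_{w₀} ≤ G` fixes
every element of a family generating `E` over `F` (in the sense that an automorphism fixing the family
is the identity), then `I_{w₀} = 1`. [folklore] -/
theorem inertia_eq_bot_of_forall_smul_eq {ι : Type*} (s : ι → E)
    (hgen : ∀ σ : E ≃ₐ[F] E, (∀ i, σ (s i) = s i) → σ = 1) (w₀ : HeightOneSpectrum (𝓞 E))
    (hfix : ∀ σ : E ≃ₐ[F] E, σ ∈ w₀.asIdeal.inertia (E ≃ₐ[F] E) → ∀ i, σ (s i) = s i) :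
    w₀.asIdeal.inertia (E ≃ₐ[F] E) = ⊥ := by
  rw [eq_bot_iff]
  intro σ hσ
  rw [Subgroup.mem_bot]
  exact hgen σ (hfix σ hσ)

omit [NumberField F] in
/-- **A Frobenius fixes the `d`-th roots of `d`-th power residues.** Let `σ` be a Frobenius at the
prime `w₀` of `E` (`σ x ≡ x^{Nv} (mod w₀)` for all `x ∈ 𝓞 E`, `v = w₀ ∩ 𝓞 F`), `a ∈ 𝓞 F` and `d` not
in `w₀`, `α ∈ 𝓞 E` with `α^d = a`, and suppose `a^{(Nv-1)/d} ≡ 1 (mod w₀)` with `d ∣ Nv - 1` (i.e.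
`a` is a `d`-th power residue modulo `v`). Then `σ α = α`: indeed `σ α ≡ α^{Nv} = α (α^d)^{(Nv-1)/d} ≡ α`
and two `d`-th roots of the `w₀`-unit `a` congruent modulo `w₀` are equal. [folklore] -/
theorem smul_eq_self_of_isArithFrobAt {σ : E ≃ₐ[F] E} {w₀ : HeightOneSpectrum (𝓞 E)}
    (hσ : IsArithFrobAt (𝓞 F) σ w₀.asIdeal) {d : ℕ} (hd : (d : 𝓞 E) ∉ w₀.asIdeal)
    {a : 𝓞 F} (ha : algebraMap (𝓞 F) (𝓞 E) a ∉ w₀.asIdeal) {α : 𝓞 E}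
    (hα : α ^ d = algebraMap (𝓞 F) (𝓞 E) a)
    (hdvd : d ∣ Nat.card (𝓞 F ⧸ w₀.asIdeal.under (𝓞 F)) - 1)
    (hres : algebraMap (𝓞 F) (𝓞 E) a ^ ((Nat.card (𝓞 F ⧸ w₀.asIdeal.under (𝓞 F)) - 1) / d) - 1 ∈
      w₀.asIdeal) :
    σ • α = α := by
  set N := Nat.card (𝓞 F ⧸ w₀.asIdeal.under (𝓞 F)) with hN
  have hN1 : 1 ≤ N := by
    have := hσ.card_pos
    omega
  -- `σ α ≡ α^N (mod w₀)` and `α^N = α · a^{(N-1)/d}`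
  have h1 : σ • α - α ^ N ∈ w₀.asIdeal := by
    simpa only [MulSemiringAction.toAlgHom_apply] using hσ α
  have h2 : α ^ N - α ∈ w₀.asIdeal := by
    have e : α ^ N = α * (algebraMap (𝓞 F) (𝓞 E) a) ^ ((N - 1) / d) := by
      rw [← hα, ← pow_mul, Nat.mul_div_cancel' hdvd, ← pow_succ', Nat.sub_add_cancel hN1]
    rw [e, show α * algebraMap (𝓞 F) (𝓞 E) a ^ ((N - 1) / d) - α =
      α * (algebraMap (𝓞 F) (𝓞 E) a ^ ((N - 1) / d) - 1) by ring]
    exact w₀.asIdeal.mul_mem_left _ hres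
  have h3 : σ • α - α ∈ w₀.asIdeal := by
    have := w₀.asIdeal.add_mem h1 h2
    rwa [sub_add_sub_cancel] at this
  -- both are `d`-th roots of `a`
  haveI := w₀.isPrime
  have hd0 : d ≠ 0 := by
    rintro rfl
    exact hd (by simp)
  have hαw : α ∉ w₀.asIdeal := fun h ↦ ha (hα ▸ w₀.asIdeal.pow_mem_of_mem h d (Nat.pos_of_ne_zero hd0))
  refine Literature.NumberTheory.EllipticCurves.eq_of_pow_eq_pow_of_sub_mem w₀.asIdeal hd hαw ?_ h3
  rw [← smul_pow', hα, algEquiv_smul_algebraMap]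

omit [NumberField F] in
/-- **Trivial inertia and trivial Frobenius give a free action (complete splitting).** If the inertia
group of `w₀` in `G = Gal(E/F)` is trivial and the identity is a Frobenius at `w₀`
(`x ≡ x^{Nv} (mod w₀)` for all `x ∈ 𝓞 E`), then `σ w₀ = w₀` forces `σ = 1`: every element of the
residue field of `w₀` is a root of `X^{Nv} - X`, so that residue field is the one of `v`; hence every
`x ∈ 𝓞 E` is `≡ c (mod w₀)` for some `c ∈ 𝓞 F`, and an automorphism fixing `w₀` lies in the inertia
group. [folklore] -/
theorem free_of_inertia_eq_bot_of_isArithFrobAt_one {w₀ : HeightOneSpectrum (𝓞 E)}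
    (hI : w₀.asIdeal.inertia (E ≃ₐ[F] E) = ⊥)
    (hfrob : IsArithFrobAt (𝓞 F) (1 : E ≃ₐ[F] E) w₀.asIdeal) (σ : E ≃ₐ[F] E) (hσ : σ • w₀ = w₀) :
    σ = 1 := by
  classical
  set Q₀ := w₀.asIdeal with hQ₀
  set p := Q₀.under (𝓞 F) with hp
  haveI : Q₀.IsMaximal := w₀.isMaximal
  haveI hpmax : p.IsMaximal := Ideal.IsMaximal.under (𝓞 F) Q₀
  letI := Ideal.Quotient.field Q₀
  letI := Ideal.Quotient.field p
  haveI : Finite (𝓞 F ⧸ p) := hfrob.finite_quotient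
  letI := Fintype.ofFinite (𝓞 F ⧸ p)
  letI := Fintype.ofFinite (𝓞 E ⧸ Q₀)
  set N := Nat.card (𝓞 F ⧸ p) with hN
  have hNcard : N = Fintype.card (𝓞 F ⧸ p) := Nat.card_eq_fintype_card
  have hN1 : 1 < N := by rw [hNcard]; exact Fintype.one_lt_card
  -- every element of the residue field of `w₀` is a root of `X^N - X`
  have hroot : ∀ y : 𝓞 E ⧸ Q₀, y ^ N = y := by
    intro y
    obtain ⟨x, rfl⟩ := Ideal.Quotient.mk_surjective y
    have h := hfrob x
    simp only [MulSemiringAction.toAlgHom_apply, one_smul] at h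
    rw [← map_pow, eq_comm, Ideal.Quotient.eq]
    exact h
  -- hence it has at most `N` elements, and the residue field of `v` maps ONTO it
  have hcardle : Fintype.card (𝓞 E ⧸ Q₀) ≤ N := by
    set P : Polynomial (𝓞 E ⧸ Q₀) := Polynomial.X ^ N - Polynomial.X with hP
    have hP0 : P ≠ 0 := FiniteField.X_pow_card_sub_X_ne_zero _ hN1
    have hdeg : P.natDegree = N := by
      rw [hP]
      exact FiniteField.X_pow_card_sub_X_natDegree_eq _ hN1
    calc Fintype.card (𝓞 E ⧸ Q₀) = (Finset.univ : Finset (𝓞 E ⧸ Q₀)).card := rfl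
      _ ≤ P.roots.toFinset.card := Finset.card_le_card fun y _ ↦ by
          rw [Multiset.mem_toFinset, Polynomial.mem_roots hP0, hP, Polynomial.IsRoot.def,
            Polynomial.eval_sub, Polynomial.eval_pow, Polynomial.eval_X, hroot y, sub_self]
      _ ≤ Multiset.card P.roots := Multiset.toFinset_card_le _
      _ ≤ P.natDegree := Polynomial.card_roots' P
      _ = N := hdeg
  have hinj : Function.Injective (algebraMap (𝓞 F ⧸ p) (𝓞 E ⧸ Q₀)) := RingHom.injective _
  have hbij : Function.Bijective (algebraMap (𝓞 F ⧸ p) (𝓞 E ⧸ Q₀)) := by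
    rw [Fintype.bijective_iff_injective_and_card]
    refine ⟨hinj, le_antisymm (Fintype.card_le_of_injective _ hinj) ?_⟩
    rw [← hNcard]
    exact hcardle
  -- `σ` fixes `w₀`, so it lies in the inertia group
  have hσQ : σ • Q₀ = Q₀ := by
    have h := congrArg HeightOneSpectrum.asIdeal hσ
    rwa [HeightOneSpectrum.smul_asIdeal] at h
  have hmem : σ ∈ Q₀.inertia (E ≃ₐ[F] E) := by
    intro x
    obtain ⟨c₀, hc₀⟩ := hbij.2 (Ideal.Quotient.mk Q₀ x)
    obtain ⟨c, rfl⟩ := Ideal.Quotient.mk_surjective c₀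
    have hxc : x - algebraMap (𝓞 F) (𝓞 E) c ∈ Q₀ := by
      rw [← Ideal.Quotient.eq, ← hc₀]
      rfl
    have h1 : σ • (x - algebraMap (𝓞 F) (𝓞 E) c) ∈ Q₀ := by
      rw [← hσQ]
      exact Ideal.smul_mem_pointwise_smul_iff.mpr hxc
    rw [smul_sub, algEquiv_smul_algebraMap] at h1
    have := Q₀.sub_mem h1 hxc
    rwa [sub_sub_sub_cancel_right] at this
  rw [hI, Subgroup.mem_bot] at hmem
  exact hmem

end SplitNorm

end Literature.NumberTheory.GaloisRepresentations
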